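import Summits.Ventures.CertifiedManyBodySolver.Downfold.EmeryOrbitalWeightFaceBox
import Summits.Ventures.CertifiedManyBodySolver.Downfold.EmeryOrbitalWeightFaceLever
import Mathlib.Analysis.Calculus.Deriv.MeanValue
import Mathlib.Analysis.Calculus.Deriv.Inv
import Mathlib.Analysis.Calculus.Deriv.Pow
import HarnessLib

/-!
# The antinodal Cu-d weight along a STRAIGHT SEGMENT in the `(Δ, ε)` plane: directional forms `faceSD`, `faceSE`, the ε-form as the §B.73 certificate at `d = 0`,
# and the derivative-sign (mean-value) step `CF(Δ, ε) ≤ CF(Δ + δ, ε − λδ)` from a ONE-POINT directional certificate `faceSD + κ₀·faceSE ≥ 0` (`κ₀ ≤ λ ≤ 1`)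
# (INFL-3to1-B §B.90 (j), part 1 of 3: the FIXED-FILLING Δ-lever of the antinodal weight WITHOUT the antinodal charge-transfer regime)

Venture CertifiedManyBodySolver, cell `pub/hubbard-downfold` (stage S1; INFLATION-RULES-3to1-B §B.73 (the antinodal ε-lever `faceCert`), §B.90 (a)–(i) (the antinodal weight
over a typed box: fixed-ENERGY coordinate levers in the regime `4(t_pp + t_pp′) ≤ Δ + ε`, the Fermi-energy slope law), §B.90 (j) (this file and its sequels
`EmeryOrbitalWeightFaceDirCert` (the region certificate), `EmeryOrbitalWeightFaceDirBox` (the regime-free box rule))), seat hubbard-downfold-mod-4 (technique B, g39);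
namespace `Summit.Ventures.CertifiedManyBodySolver.Downfold.Emery`. Everything PROVED (0 sorry).
WHAT THIS IS NOT: a statement about any material; `U = 0` one-body kinematics of the σ (d–pₓ–p_y + t_pp + t_pp′) model.

WHY. The (K) cuprate source boxes and box #19 sit at `(Δ + ε_F)/4(t_pp + t_pp′) ≈ 0.7–1.0`, where the fixed-ENERGY Δ-lever of `w_face = a²faceN/(a²faceN + faceR)` is NOT
sign-definite (§B.90 (h)); at fixed FILLING the Fermi energy drops at rate `λ = −dε_F/dΔ ∈ [κ, 1]` (`EmeryChargeTransferLipschitz`, slope law `EmeryChargeTransferSlopeBox`),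
and along the direction `(dΔ, dε) = (1, −λ)` the derivative of the closed form is `a²(faceSD + λ·faceSE)/(a²faceN + faceR)²` (§3) with `faceSE ≥ 0` the §B.73 ε-lever in
derivative form (§2). So a certificate `faceSD + κ₀faceSE ≥ 0` on a region (sequel, found by LP, checked by `ring`) plus `κ₀ ≤ λ` gives `dW/dt ≥ 0` along the straight
segment from `(Δ, ε_F(Δ))` to `(Δ + δ, ε_F(Δ + δ))`, on which the hole-like window persists because `faceG` is concave along it (§4); the mean value theorem
(`monotoneOn_of_hasDerivWithinAt_nonneg`) turns the sign into `CF(Δ, ε) ≤ CF(Δ + δ, ε − λδ)` (§5). No regime hypothesis anywhere.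

* §1 `dfaceN = ∂faceN/∂Δ = ∂faceN/∂ε = (E + 4g)(3E + 4g)`, `dfaceRD = ∂faceR/∂Δ`, `dfaceRE = ∂faceR/∂ε`, `faceSD = dfaceN·faceR − faceN·dfaceRD`, `faceSE = faceN·dfaceRE − dfaceN·faceR`.
* §2 `faceSE(Δ, a, c + h, c; ε) = faceCert(Δ, ε, 0, a, c, h, faceG, faceU, a² − cε)` (`ring`) ⇒ `faceSE ≥ 0` on the window (`faceG ≥ 0`, `faceU ≥ 0`, `cε ≤ a²`).
* §3 `HasDerivAt` of `faceN`, `faceR` and `dWeightFaceCF` along `t ↦ (Δ + t, ε − λt)`: derivative `a²(faceSD + λfaceSE)/(a²faceN + faceR)²`.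
* §4 `faceG` is a concave quadratic along the segment (`λ ∈ [0, 1]`): non-negative at both ends ⇒ non-negative along.
* §5 `dWeightFaceCF_seg_mono`: `0 ≤ κ₀ ≤ λ ≤ 1`, window data at the two ends + the upper edge along, and the directional certificate along ⇒ `CF(Δ; ε) ≤ CF(Δ + δ; ε − λδ)`.

Sources: three-band model [HybertsenSchluterChristensen1989, Eq. (1)]; bilinear contour / face point [AndersenEtAl1995, §6]; Handelman certificates [folklore] (Handelman 1988,
Pac. J. Math. 132); mean value theorem [folklore].
-/

noncomputable section

namespace Summit.Ventures.CertifiedManyBodySolver.Downfold.Emery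

open Real Set

/-! ## §1 The directional forms -/

/-- `dfaceN = ∂faceN/∂Δ = ∂faceN/∂ε = (E + 4g)(3E + 4g)`, `E = Δ + ε`, `g = t_pp + t_pp′` (`faceN = E(E + 4g)²` sees `Δ, ε` through `E` only). [folklore] -/
def dfaceN (Δ b c ε : ℝ) : ℝ := ((Δ + ε) + 4 * (b + c)) * (3 * (Δ + ε) + 4 * (b + c))

/-- `dfaceRD = ∂faceR/∂Δ = 2εE(a² − cε) + 8ε·fsN`. [folklore] -/
def dfaceRD (Δ a b c ε : ℝ) : ℝ := 2 * ε * (Δ + ε) * (a ^ 2 - c * ε) + 8 * fsN a b c ε * ε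

/-- `dfaceRE = ∂faceR/∂ε = E²(a² − cε) + 2εE(a² − cε) − cεE² + 8(b² − c²)(εE − 2(a² − cε)) + 8fsN(E + ε + 2c)`. [folklore] -/
def dfaceRE (Δ a b c ε : ℝ) : ℝ :=
  (Δ + ε) ^ 2 * (a ^ 2 - c * ε) + 2 * ε * (Δ + ε) * (a ^ 2 - c * ε) - c * ε * (Δ + ε) ^ 2 +
    8 * (b ^ 2 - c ^ 2) * (ε * (Δ + ε) - 2 * (a ^ 2 - c * ε)) + 8 * fsN a b c ε * ((Δ + ε) + ε + 2 * c)

/-- **The Δ-directional form** `faceSD = dfaceN·faceR − faceN·dfaceRD` (sign of `∂w_face/∂Δ` at fixed energy). [folklore] -/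
def faceSD (Δ a b c ε : ℝ) : ℝ := dfaceN Δ b c ε * faceR Δ a b c ε - faceN Δ b c ε * dfaceRD Δ a b c ε

/-- **The ε-directional form** `faceSE = faceN·dfaceRE − dfaceN·faceR` (sign of `−∂w_face/∂ε` at fixed `Δ`). [folklore] -/
def faceSE (Δ a b c ε : ℝ) : ℝ := faceN Δ b c ε * dfaceRE Δ a b c ε - dfaceN Δ b c ε * faceR Δ a b c ε

/-! ## §2 The ε-form is the §B.73 certificate at `d = 0` -/

/-- **`faceSE` IS THE §B.73 TWO-POINT CERTIFICATE AT `d = 0`**: `faceSE(Δ, a, c + h, c; ε) = faceCert(Δ, ε, 0, a, c, h, faceG(ε), faceU(ε), a² − cε)` — the `d`-linear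
coefficient of `faceN(ε)faceR(ε + d) − faceN(ε + d)faceR(ε) = d·faceCert` (`faceN_mul_faceR_sub`). [folklore] -/
theorem faceSE_eq_faceCert (Δ a c h ε : ℝ) :
    faceSE Δ a (c + h) c ε = faceCert Δ ε 0 a c h (faceG Δ a c ε) (faceU Δ a (c + h) c ε) (a ^ 2 - c * ε) := by
  unfold faceSE dfaceN dfaceRE faceN faceR faceU fsN fsD cA faceG faceCert faceCertP1 faceCertP2 faceCertP3 faceCertP4 faceCertP5 faceCertP6
    faceCertP7 faceCertP8 faceCertP9 faceCertP10
  ring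

/-- **`faceSE ≥ 0` ON THE WINDOW** (`Δ, ε ≥ 0`, `0 ≤ t_pp′ ≤ t_pp`, `faceG ≥ 0`, `faceU ≥ 0`, `t_pp′ε ≤ a²`): the antinodal weight is non-increasing in the energy, derivative form.
[folklore] -/
theorem faceSE_nonneg {Δ a b c ε : ℝ} (hΔ : 0 ≤ Δ) (hε : 0 ≤ ε) (hc : 0 ≤ c) (hcb : c ≤ b) (hG : 0 ≤ faceG Δ a c ε) (hU : 0 ≤ faceU Δ a b c ε)
    (hM : c * ε ≤ a ^ 2) : 0 ≤ faceSE Δ a b c ε := by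
  obtain ⟨h, rfl⟩ : ∃ h, b = c + h := ⟨b - c, by ring⟩
  have hh : 0 ≤ h := by linarith
  have hM' : 0 ≤ a ^ 2 - c * ε := by linarith
  rw [faceSE_eq_faceCert]
  set G₁ := faceG Δ a c ε
  set G₂ := faceU Δ a (c + h) c ε
  set M₂ := a ^ 2 - c * ε
  have p1 : 0 ≤ faceCertP1 Δ ε 0 a c h G₁ G₂ M₂ := faceCertP1_nonneg (tpd := a) (h1 := hε) (hd := le_rfl) (hc := hc) (hh := hh)
  have p2 : 0 ≤ faceCertP2 Δ ε 0 a c h G₁ G₂ M₂ := faceCertP2_nonneg (tpd := a) (hΔ := hΔ) (h1 := hε) (hd := le_rfl) (hc := hc) (hh := hh)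
  have p3 : 0 ≤ faceCertP3 Δ ε 0 a c h G₁ G₂ M₂ := faceCertP3_nonneg (tpd := a) (hΔ := hΔ) (h1 := hε) (hd := le_rfl) (hc := hc) (hh := hh)
  have p4 : 0 ≤ faceCertP4 Δ ε 0 a c h G₁ G₂ M₂ := faceCertP4_nonneg (tpd := a) (hΔ := hΔ) (h1 := hε) (hd := le_rfl) (hc := hc) (hh := hh)
  have p5 : 0 ≤ faceCertP5 Δ ε 0 a c h G₁ G₂ M₂ := faceCertP5_nonneg (tpd := a) (hΔ := hΔ) (h1 := hε) (hd := le_rfl) (hc := hc) (hh := hh) (hG₁ := hG)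
  have p6 : 0 ≤ faceCertP6 Δ ε 0 a c h G₁ G₂ M₂ := faceCertP6_nonneg (tpd := a) (hΔ := hΔ) (h1 := hε) (hd := le_rfl) (hc := hc) (hh := hh) (hG₁ := hG)
  have p7 : 0 ≤ faceCertP7 Δ ε 0 a c h G₁ G₂ M₂ := faceCertP7_nonneg (tpd := a) (hΔ := hΔ) (h1 := hε) (hd := le_rfl) (hc := hc) (hh := hh) (hG₁ := hG) (hG₂ := hU)
  have p8 : 0 ≤ faceCertP8 Δ ε 0 a c h G₁ G₂ M₂ := faceCertP8_nonneg (tpd := a) (hΔ := hΔ) (h1 := hε) (hd := le_rfl) (hc := hc) (hh := hh) (hG₂ := hU)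
  have p9 : 0 ≤ faceCertP9 Δ ε 0 a c h G₁ G₂ M₂ := faceCertP9_nonneg (tpd := a) (hΔ := hΔ) (h1 := hε) (hd := le_rfl) (hc := hc) (hh := hh) (hG₂ := hU) (hM₂ := hM')
  have p10 : 0 ≤ faceCertP10 Δ ε 0 a c h G₁ G₂ M₂ :=
    faceCertP10_nonneg (tpd := a) (hΔ := hΔ) (h1 := hε) (hd := le_rfl) (hc := hc) (hh := hh) (hG₁ := hG) (hG₂ := hU) (hM₂ := hM')
  unfold faceCert
  nlinarith

/-! ## §3 Derivatives along the segment `t ↦ (Δ + t, ε − λt)` -/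

section Deriv

variable (Δ a b c ε l : ℝ)

/-- `d/dt faceN(Δ + t, b, c, ε − λt) = (1 − λ)·dfaceN`. [folklore] -/
theorem hasDerivAt_faceN_seg (t : ℝ) :
    HasDerivAt (fun s => faceN (Δ + s) b c (ε - l * s)) ((1 - l) * dfaceN (Δ + t) b c (ε - l * t)) t := by
  have hE : HasDerivAt (fun s : ℝ => (Δ + ε) + (1 - l) * s) (1 - l) t := by
    simpa using ((hasDerivAt_id t).const_mul (1 - l)).const_add (Δ + ε)
  have h := hE.mul ((hE.add_const (4 * (b + c))).pow 2)
  have e : (fun s => faceN (Δ + s) b c (ε - l * s)) = fun s => ((Δ + ε) + (1 - l) * s) * (((Δ + ε) + (1 - l) * s) + 4 * (b + c)) ^ 2 := by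
    funext s; unfold faceN; ring
  rw [e]
  refine h.congr_deriv ?_
  simp only [Pi.pow_apply, Nat.reduceSub, pow_one, Nat.cast_ofNat]
  unfold dfaceN; ring

/-- `d/dt faceR(Δ + t, a, b, c, ε − λt) = dfaceRD − λ·dfaceRE`. [folklore] -/
theorem hasDerivAt_faceR_seg (t : ℝ) :
    HasDerivAt (fun s => faceR (Δ + s) a b c (ε - l * s)) (dfaceRD (Δ + t) a b c (ε - l * t) - l * dfaceRE (Δ + t) a b c (ε - l * t)) t := by
  have hE : HasDerivAt (fun s : ℝ => (Δ + ε) + (1 - l) * s) (1 - l) t := by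
    simpa using ((hasDerivAt_id t).const_mul (1 - l)).const_add (Δ + ε)
  have he : HasDerivAt (fun s : ℝ => ε + (-l) * s) (-l) t := by
    simpa using ((hasDerivAt_id t).const_mul (-l)).const_add ε
  have hM : HasDerivAt (fun s : ℝ => (a ^ 2 - c * ε) + (c * l) * s) (c * l) t := by
    simpa using ((hasDerivAt_id t).const_mul (c * l)).const_add (a ^ 2 - c * ε)
  have hF : HasDerivAt (fun s : ℝ => (2 * a ^ 2 * (c + b) + ε * (b ^ 2 - c ^ 2)) + (-(l * (b ^ 2 - c ^ 2))) * s) (-(l * (b ^ 2 - c ^ 2))) t := by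
    simpa using ((hasDerivAt_id t).const_mul (-(l * (b ^ 2 - c ^ 2)))).const_add (2 * a ^ 2 * (c + b) + ε * (b ^ 2 - c ^ 2))
  have h := ((he.mul (hE.pow 2)).mul hM).add (((hF.mul ((he.mul hE).sub (hM.const_mul 2))).const_mul 8))
  have e : (fun s => faceR (Δ + s) a b c (ε - l * s)) = fun s =>
      (ε + (-l) * s) * ((Δ + ε) + (1 - l) * s) ^ 2 * ((a ^ 2 - c * ε) + (c * l) * s) +
        8 * (((2 * a ^ 2 * (c + b) + ε * (b ^ 2 - c ^ 2)) + (-(l * (b ^ 2 - c ^ 2))) * s) *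
          ((ε + (-l) * s) * ((Δ + ε) + (1 - l) * s) - 2 * ((a ^ 2 - c * ε) + (c * l) * s))) := by
    funext s; unfold faceR fsN; ring
  rw [e]
  refine h.congr_deriv ?_
  simp only [Pi.pow_apply, Pi.mul_apply, Pi.sub_apply, Nat.reduceSub, pow_one, Nat.cast_ofNat]
  unfold dfaceRD dfaceRE fsN; ring

/-- **THE DERIVATIVE OF THE CLOSED FORM ALONG THE SEGMENT**: where `a²faceN + faceR ≠ 0`,
`d/dt dWeightFaceCF(Δ + t, a, b, c, ε − λt) = a²(faceSD + λ·faceSE)/(a²faceN + faceR)²` (quotient rule; `N_Δ = N_ε`). [folklore] -/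
theorem hasDerivAt_dWeightFaceCF_seg (t : ℝ) (hW : a ^ 2 * faceN (Δ + t) b c (ε - l * t) + faceR (Δ + t) a b c (ε - l * t) ≠ 0) :
    HasDerivAt (fun s => dWeightFaceCF (Δ + s) a b c (ε - l * s))
      (a ^ 2 * (faceSD (Δ + t) a b c (ε - l * t) + l * faceSE (Δ + t) a b c (ε - l * t)) /
        (a ^ 2 * faceN (Δ + t) b c (ε - l * t) + faceR (Δ + t) a b c (ε - l * t)) ^ 2) t := by
  have hN := hasDerivAt_faceN_seg Δ b c ε l t
  have hR := hasDerivAt_faceR_seg Δ a b c ε l t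
  have h := (hN.const_mul (a ^ 2)).fun_div ((hN.const_mul (a ^ 2)).add hR) hW
  have e : (fun s => dWeightFaceCF (Δ + s) a b c (ε - l * s)) =
      fun s => a ^ 2 * faceN (Δ + s) b c (ε - l * s) / (a ^ 2 * faceN (Δ + s) b c (ε - l * s) + faceR (Δ + s) a b c (ε - l * s)) := by
    funext s; unfold dWeightFaceCF; ring
  rw [e]
  refine h.congr_deriv ?_
  simp only [Pi.add_apply]
  unfold faceSD faceSE
  field_simp
  ring

end Deriv

/-! ## §4 The hole-like window persists along the segment -/

/-- `faceG(Δ + t, a, c, ε − λt) = −λ(1 − λ)t² + (coefficient)·t + faceG(Δ, a, c, ε)` — a concave quadratic in `t` for `λ ∈ [0, 1]`; non-negative at `t = 0` and `t = δ` ⇒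
non-negative on `[0, δ]`. [folklore] -/
theorem faceG_seg_nonneg {Δ a c ε l δ t : ℝ} (hl0 : 0 ≤ l) (hl1 : l ≤ 1) (ht : t ∈ Icc 0 δ) (hG0 : 0 ≤ faceG Δ a c ε)
    (hG1 : 0 ≤ faceG (Δ + δ) a c (ε - l * δ)) : 0 ≤ faceG (Δ + t) a c (ε - l * t) := by
  have e : ∀ s : ℝ, faceG (Δ + s) a c (ε - l * s) =
      -(l * (1 - l)) * s ^ 2 + ((1 - l) * ε - l * (Δ + ε) - 4 * c * l) * s + faceG Δ a c ε := by
    intro s; unfold faceG; ring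
  have hα : 0 ≤ l * (1 - l) := mul_nonneg hl0 (by linarith)
  have hmin := concaveQuad_ge_min (α := l * (1 - l)) (β := (1 - l) * ε - l * (Δ + ε) - 4 * c * l) (γ := faceG Δ a c ε) hα ht
  have h0 : -(l * (1 - l)) * (0 : ℝ) ^ 2 + ((1 - l) * ε - l * (Δ + ε) - 4 * c * l) * 0 + faceG Δ a c ε = faceG Δ a c ε := by ring
  rw [h0, ← e δ] at hmin
  rw [e t]
  exact le_trans (le_min hG0 hG1) hmin

/-! ## §5 The mean-value step -/

/-- **THE SEGMENT STEP.** `Δ > 0`, `a ≠ 0`, `0 ≤ t_pp′ ≤ t_pp`, `δ ≥ 0`, `0 ≤ κ₀ ≤ λ ≤ 1`, `ε − λδ > 0`, `t_pp′ε < a²`, the contour hole-like at both ends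
(`faceG(Δ; ε) ≥ 0`, `faceG(Δ + δ; ε − λδ) ≥ 0`), the upper face edge along the segment, and the ONE-POINT DIRECTIONAL CERTIFICATE along it
(`faceG ≥ 0 ⇒ faceSD + κ₀faceSE ≥ 0` at every `(Δ + t, ε − λt)`, `t ∈ [0, δ]`) ⇒ **`dWeightFaceCF(Δ; ε) ≤ dWeightFaceCF(Δ + δ; ε − λδ)`**. [folklore] -/
theorem dWeightFaceCF_seg_mono {Δ a b c ε l δ κ₀ : ℝ} (hΔ : 0 < Δ) (ha : a ≠ 0) (hc : 0 ≤ c) (hcb : c ≤ b) (hδ : 0 ≤ δ) (hκ₀ : 0 ≤ κ₀) (hκl : κ₀ ≤ l)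
    (hl1 : l ≤ 1) (hε' : 0 < ε - l * δ) (hm : c * ε < a ^ 2) (hG0 : 0 ≤ faceG Δ a c ε) (hG1 : 0 ≤ faceG (Δ + δ) a c (ε - l * δ))
    (hU : ∀ t ∈ Icc 0 δ, 0 ≤ faceU (Δ + t) a b c (ε - l * t))
    (hdir : ∀ t ∈ Icc 0 δ, 0 ≤ faceG (Δ + t) a c (ε - l * t) → 0 ≤ faceSD (Δ + t) a b c (ε - l * t) + κ₀ * faceSE (Δ + t) a b c (ε - l * t)) :
    dWeightFaceCF Δ a b c ε ≤ dWeightFaceCF (Δ + δ) a b c (ε - l * δ) := by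
  have hl0 : 0 ≤ l := hκ₀.trans hκl
  set f : ℝ → ℝ := fun s => dWeightFaceCF (Δ + s) a b c (ε - l * s) with hf
  -- pointwise facts on [0, δ]
  have hpt : ∀ t ∈ Icc 0 δ, 0 < ε - l * t ∧ c * (ε - l * t) < a ^ 2 ∧ 0 ≤ faceG (Δ + t) a c (ε - l * t) ∧
      0 < a ^ 2 * faceN (Δ + t) b c (ε - l * t) + faceR (Δ + t) a b c (ε - l * t) ∧
      0 ≤ faceSD (Δ + t) a b c (ε - l * t) + l * faceSE (Δ + t) a b c (ε - l * t) := by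
    intro t ht
    have hεt : 0 < ε - l * t := lt_of_lt_of_le hε' (by nlinarith [ht.2, hl0])
    have hmt : c * (ε - l * t) < a ^ 2 := lt_of_le_of_lt (mul_le_mul_of_nonneg_left (by nlinarith [ht.1, hl0]) hc) hm
    have hGt := faceG_seg_nonneg hl0 hl1 ht hG0 hG1
    have hEt : 0 < Δ + t + (ε - l * t) := by linarith [ht.1]
    have hR := faceR_pos hEt hc hcb hεt hmt hGt
    have hN := faceN_pos (Δ := Δ + t) (ε := ε - l * t) hEt (by linarith : 0 ≤ b + c)
    have ha2 : 0 < a ^ 2 := by positivity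
    have hW : 0 < a ^ 2 * faceN (Δ + t) b c (ε - l * t) + faceR (Δ + t) a b c (ε - l * t) := by positivity
    have hSE := faceSE_nonneg (by linarith [ht.1]) hεt.le hc hcb hGt (hU t ht) hmt.le
    have hT := hdir t ht hGt
    refine ⟨hεt, hmt, hGt, hW, ?_⟩
    have e : faceSD (Δ + t) a b c (ε - l * t) + l * faceSE (Δ + t) a b c (ε - l * t) =
        (faceSD (Δ + t) a b c (ε - l * t) + κ₀ * faceSE (Δ + t) a b c (ε - l * t)) + (l - κ₀) * faceSE (Δ + t) a b c (ε - l * t) := by ring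
    rw [e]
    have : 0 ≤ (l - κ₀) * faceSE (Δ + t) a b c (ε - l * t) := mul_nonneg (by linarith) hSE
    linarith
  have hderiv : ∀ t ∈ Icc 0 δ, HasDerivAt f (a ^ 2 * (faceSD (Δ + t) a b c (ε - l * t) + l * faceSE (Δ + t) a b c (ε - l * t)) /
      (a ^ 2 * faceN (Δ + t) b c (ε - l * t) + faceR (Δ + t) a b c (ε - l * t)) ^ 2) t :=
    fun t ht => hasDerivAt_dWeightFaceCF_seg Δ a b c ε l t (hpt t ht).2.2.2.1.ne'
  have hcont : ContinuousOn f (Icc 0 δ) := fun t ht => (hderiv t ht).continuousAt.continuousWithinAt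
  have hmono : MonotoneOn f (Icc 0 δ) := by
    refine monotoneOn_of_hasDerivWithinAt_nonneg (convex_Icc 0 δ) hcont
      (f' := fun t => a ^ 2 * (faceSD (Δ + t) a b c (ε - l * t) + l * faceSE (Δ + t) a b c (ε - l * t)) /
        (a ^ 2 * faceN (Δ + t) b c (ε - l * t) + faceR (Δ + t) a b c (ε - l * t)) ^ 2) (fun t ht => ?_) (fun t ht => ?_)
    · rw [interior_Icc] at ht
      exact (hderiv t (Ioo_subset_Icc_self ht)).hasDerivWithinAt
    · rw [interior_Icc] at ht
      have h := hpt t (Ioo_subset_Icc_self ht)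
      have ha2 : 0 ≤ a ^ 2 := sq_nonneg a
      exact div_nonneg (mul_nonneg ha2 h.2.2.2.2) (sq_nonneg _)
  have h0 : (0 : ℝ) ∈ Icc 0 δ := ⟨le_rfl, hδ⟩
  have h1 : δ ∈ Icc 0 δ := ⟨hδ, le_rfl⟩
  have := hmono h0 h1 hδ
  simpa [hf] using this

end Summit.Ventures.CertifiedManyBodySolver.Downfold.Emery
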